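/-
Copyright: the b2b-balaban T⁴-continuum CRUX team, row NE7b OWNER lineage `t4-ne7b-p1` (gen 130). Project licence.
-/
import Summits.QuantumFields.BalabanUV.T4Continuum.Spine.NE7b.SupEffectiveActionGradientSmall
import Summits.QuantumFields.BalabanUV.T4Continuum.Spine.NE7b.SupEffectiveActionMixedLocality
import Summits.QuantumFields.BalabanUV.T4Continuum.Spine.NE7b.SupClusterSeparation

/-!
# TWO ONE-SITE PERTURBATIONS OF THE REMAINDER AT FAR-APART CELLS MOVE THE SMALL-FIELD FREE ENERGY BY AN EXPONENTIALLY SMALL MIXED AMOUNT: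
# for the road's step `Z(s,t) = ∫e^{−Σ_{p∈S}Σ_{x∈cell p}(w_x − s1_{x=y}F_x − t1_{x=z}G_x)(ω_x+ψ₀,x)}dN(0,Γ)` with quadratic profiles
# `|F|, |G| ≤ c₂t²`, `|s|, |t| ≤ 1`, `y ∈ cell p₀`, `z ∈ cell p₁`, and a potential `d` on the cells, `1`-Lipschitz along the adjacency `R`, with
# `d(p₀) = 0`, `d(p₁) ≥ n + 2`:
#   `|log Z(s,t) − log Z(s,0) − log Z(0,t) + log Z(0,0)| ≤ 4·e^{−η(n+1)}·(Δ+1)·2e^{1+η}·ε̃_ΨA_τ^v`,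
# `ε̃ = max(e^{v(c₃h³+2c₂h²)}−1, 2e^{−(κ∕2−(κ₀+2c₂))h²})` — the road-level instance of (324)'s mixed locality with (325)'s separation: the
# finite-difference shadow of the exponential decay of `Cov_ν(F_y, G_z) = ∂_s∂_t log Z(s,t)|₀` (row NE7b, node U5c; (314)∕(315)∕(324)∕(325)
# BY NAME; [folklore])

Cell `pub-balaban`, sub-cell `t4`, spine estimate NE7b (`T4WeightBudget.RelWeightBound`; the cell's OWN estimate — NOT PRINTED in
[Bałaban 1983–89], NOT PROVED).  Crux-route work under `Spine/NE7b/` by the row OWNER (`t4-ne7b-p1` gen 130, file (326)) under FREEZE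
(0)'s crux-prover clause, on § [NE7bP1-G129-HANDOFF] NEXT (i)∕(ii) («the `O(ε)` covariance bound»: its finite-difference form on the road);
NOTHING of Bałaban's is named as a Lean object, valued or asserted; no `T4Continuum/Support` leaf typed; no `def`, no notation; zero `sorry`.
Imports (BY NAME): the OWNER's (315) `…SupEffectiveActionGradientSmall` (through it (314) `cubic_supSmall`, `supSmall_factor_norm_le`,
`supSmall_eps_nonneg`, `oneSite_measurable`, (306) `shifted_exp_pertLogZ_on`, `pertZ_road_shift_eq`, (296) `pertLogZ_cutoff`,
`cellActivity_cutoff_of_subset`, `cutoff_shifted_regulated`, (289) `norm_cellActivity_le_of_regulated`, (290) `road_factor_measurable`, (311)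
`re_eq_log_of_exp_eq`), (324) `…SupEffectiveActionMixedLocality` (`act_norm_pertLogZ_mixed_le`), (325) `…SupClusterSeparation`
(`cluster_size_ge_of_touches`), (312) (`smallness_of_decay`); the tree's `symm_of_inst`.

WHY (located).  (324) is the activity-level statement and (325) its geometric letter; the road consumes them on its small-field step with
two one-site perturbations of the remainder — the `s`- and `t`-derivatives at `0` of `log Z(s,t)` are the tilted means of `F_y`, `G_z` and
the mixed derivative is their tilted covariance ((313)'s pattern).  This file produces the finite-difference statement with all letters
discharged by the road's regulated factors: both perturbations stay in the regulated class with one constant `ε̃` ((314)'s bricks twice),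
the four free energies are real parts of KP logarithms of cut-off shifted families ((315)'s bridge), these agree off `{p₀}` in `s` and off
`{p₁}` in `t`, and clusters through both cells are large by (325).

WHAT IS PROVED ([folklore]; road data as in (315): `Γ ⪰ 0` of range `ρ`, `Γ ⪯ γ_op·1`, diagonal `≤ γ`; disjoint cells of `≤ v` sites; `R`
symmetric covering `ρ`-closeness with `≤ Δ` neighbours; measurable `w, F, G` with `−κ₀t² ≤ w`, `|w| ≤ c₃|t|³` on `|t| ≤ h`, `|F|, |G| ≤ c₂t²`;
`2(κ₀+2c₂) ≤ κ`, `κ(1+τ)γ_op ≤ θ < 1`; `ψ₀` small on the cells of `S`):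
* §1 the two-site perturbed family `w̃ = w − s1_yF − t1_zG` (`|s|, |t| ≤ 1`): `twoSite_measurable`, `twoSite_stable` (`κ₀ + 2c₂`),
  `twoSite_supSmall` (`c₃h³ + 2c₂h²`), **`twoSite_regulated`** (the cell factors are `ε̃`-regulated, (314)'s `supSmall_factor_norm_le`);
* §2 THE END **`abs_log_twoSite_mixed_le`** (displayed above; decay smallness `e^{1+η}·ε̃_ΨA_τ^v·(Δ+1)² ≤ ½`, `0 ≤ η`); §3 toy.

HONEST (what this is NOT).  Finite differences in `(s,t)`, uniformly `O(e^{−η(n+1)}ε̃)` — NOT yet `|Cov_ν(F_y,G_z)| ≤ C·e^{−η(n+1)}` (the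
bound is not bilinear in `s, t`; the differences→derivative device — Cauchy estimates for complex `s, t`, or second activity-derivatives
of `log Z` — is the successor's, SCOPING-d4); the small-field step only; scalar skeleton ((A3), NC-NE7b-α UNRULED); nothing of Bałaban's
asserted.  BY-NAME EFFECT ON THE WALL: NONE.  NE7b NOT PRINTED ∕ NOT PROVED; spine PROVED 0∕9; rung (B)+1 — the programme's measures remain
FINITE-torus statements; NOT the mass gap, NOT Clay.  HONEST DEPENDENCY: continuum YM on T⁴ ⇐ BetaPertH ∧ nine spine estimates (0∕9 proved);
BetaPertH ⇐ (D1) ∧ (D4) ∧ CAP+tail; G-an2-4 gates asym, D1 and NE2∕3∕4.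
-/

set_option autoImplicit false

noncomputable section

namespace Summit.QuantumFields.BalabanUV.T4Continuum.NE7b.SupTwoSitePerturbationLocality

open MeasureTheory ProbabilityTheory Finset Real
open scoped BigOperators
open Literature.Probability.LatticeModels (IsRConnected pertZ cellActivity pertLogZ symm_of_inst KPTouches GeomInc IsPolymerCluster
  rconnSubsets)
open Literature.Analysis.Matrix (HasFiniteRange)
open SupOneSitePerturbation (supSmall_factor_norm_le supSmall_eps_nonneg cubic_supSmall oneSite_measurable)
open SupEffectiveActionLocality (re_eq_log_of_exp_eq)
open SupSmallFieldGasReal (shifted_exp_pertLogZ_on pertZ_road_shift_eq)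
open SupLocalisedPolymerGas (pertLogZ_cutoff cellActivity_cutoff_of_subset cutoff_shifted_regulated)
open SupRoadFactorRegulated (road_factor_measurable)
open SupRegulatedActivityBound (norm_cellActivity_le_of_regulated)
open SupEffectiveActionMixedLocality (act_norm_pertLogZ_mixed_le)
open SupClusterSeparation (cluster_size_ge_of_touches)
open SupEffectiveActionLocalExpansion (smallness_of_decay)

variable {ι : Type} [Fintype ι] [DecidableEq ι] {V : Type*} [DecidableEq V]

/-! ## §1. The two-site perturbed family is regulated -/

section TwoSite

variable (w F G : ι → ℝ → ℝ) (y z : ι) (s t : ℝ)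

omit [Fintype ι] in
/-- The two-site perturbed remainders are measurable. [folklore] -/
theorem twoSite_measurable (hw : ∀ x, Measurable (w x)) (hF : ∀ x, Measurable (F x)) (hG : ∀ x, Measurable (G x)) (x : ι) :
    Measurable fun u => w x u - s * (if x = y then F x u else 0) - t * (if x = z then G x u else 0) :=
  oneSite_measurable (fun x u => w x u - s * (if x = y then F x u else 0)) G z t (fun x => oneSite_measurable w F y s hw hF x) hG x

omit [Fintype ι] in
/-- **Stability of the two-site perturbed family**: `−κ₀t² ≤ w`, `|F|, |G| ≤ c₂t²`, `|s|, |t| ≤ 1`, `0 ≤ c₂` ⟹ `−(κ₀+2c₂)u² ≤ w̃_x(u)`. [folklore] -/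
theorem twoSite_stable {κ₀ c₂ : ℝ} (hc₂ : 0 ≤ c₂) (hstab : ∀ x, ∀ u : ℝ, -(κ₀ * u ^ 2) ≤ w x u) (hFq : ∀ x u, |F x u| ≤ c₂ * u ^ 2)
    (hGq : ∀ x u, |G x u| ≤ c₂ * u ^ 2) (hs : |s| ≤ 1) (ht : |t| ≤ 1) (x : ι) (u : ℝ) :
    -((κ₀ + 2 * c₂) * u ^ 2) ≤ w x u - s * (if x = y then F x u else 0) - t * (if x = z then G x u else 0) := by
  have h1 : |s * (if x = y then F x u else 0)| ≤ c₂ * u ^ 2 := by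
    rw [abs_mul]
    have hb : |(if x = y then F x u else 0)| ≤ c₂ * u ^ 2 := by
      split_ifs
      · exact hFq x u
      · rw [abs_zero]; positivity
    calc |s| * |(if x = y then F x u else 0)| ≤ 1 * (c₂ * u ^ 2) := mul_le_mul hs hb (abs_nonneg _) zero_le_one
      _ = c₂ * u ^ 2 := one_mul _
  have h2 : |t * (if x = z then G x u else 0)| ≤ c₂ * u ^ 2 := by
    rw [abs_mul]
    have hb : |(if x = z then G x u else 0)| ≤ c₂ * u ^ 2 := by
      split_ifs
      · exact hGq x u
      · rw [abs_zero]; positivity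
    calc |t| * |(if x = z then G x u else 0)| ≤ 1 * (c₂ * u ^ 2) := mul_le_mul ht hb (abs_nonneg _) zero_le_one
      _ = c₂ * u ^ 2 := one_mul _
  have h3 := hstab x u
  have h1' := (abs_le.1 h1).2
  have h2' := (abs_le.1 h2).2
  linarith

omit [Fintype ι] in
/-- **Sup-smallness of the two-site perturbed family on small fields**: `|w| ≤ c₃|u|³` on `|u| ≤ h`, `|F|, |G| ≤ c₂u²`, `|s|, |t| ≤ 1` ⟹
`|w̃_x(u)| ≤ c₃h³ + 2c₂h²` for `|u| ≤ h`. [folklore] -/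
theorem twoSite_supSmall {c₃ c₂ h : ℝ} (hc₃ : 0 ≤ c₃) (hc₂ : 0 ≤ c₂) (hcub : ∀ x, ∀ u : ℝ, |u| ≤ h → |w x u| ≤ c₃ * |u| ^ 3)
    (hFq : ∀ x u, |F x u| ≤ c₂ * u ^ 2) (hGq : ∀ x u, |G x u| ≤ c₂ * u ^ 2) (hs : |s| ≤ 1) (ht : |t| ≤ 1) (x : ι) (u : ℝ)
    (hu : |u| ≤ h) : |w x u - s * (if x = y then F x u else 0) - t * (if x = z then G x u else 0)| ≤ c₃ * h ^ 3 + 2 * c₂ * h ^ 2 := by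
  have hw := cubic_supSmall w hc₃ hcub x u hu
  have hu2 : u ^ 2 ≤ h ^ 2 := by rw [← sq_abs u]; exact pow_le_pow_left₀ (abs_nonneg u) hu 2
  have h1 : |s * (if x = y then F x u else 0)| ≤ c₂ * h ^ 2 := by
    rw [abs_mul]
    have hb : |(if x = y then F x u else 0)| ≤ c₂ * h ^ 2 := by
      split_ifs
      · exact (hFq x u).trans (mul_le_mul_of_nonneg_left hu2 hc₂)
      · rw [abs_zero]; positivity
    calc |s| * |(if x = y then F x u else 0)| ≤ 1 * (c₂ * h ^ 2) := mul_le_mul hs hb (abs_nonneg _) zero_le_one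
      _ = c₂ * h ^ 2 := one_mul _
  have h2 : |t * (if x = z then G x u else 0)| ≤ c₂ * h ^ 2 := by
    rw [abs_mul]
    have hb : |(if x = z then G x u else 0)| ≤ c₂ * h ^ 2 := by
      split_ifs
      · exact (hGq x u).trans (mul_le_mul_of_nonneg_left hu2 hc₂)
      · rw [abs_zero]; positivity
    calc |t| * |(if x = z then G x u else 0)| ≤ 1 * (c₂ * h ^ 2) := mul_le_mul ht hb (abs_nonneg _) zero_le_one
      _ = c₂ * h ^ 2 := one_mul _
  calc _ ≤ |w x u - s * (if x = y then F x u else 0)| + |t * (if x = z then G x u else 0)| := abs_sub _ _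
    _ ≤ |w x u| + |s * (if x = y then F x u else 0)| + |t * (if x = z then G x u else 0)| := by
        linarith [abs_sub (w x u) (s * (if x = y then F x u else 0))]
    _ ≤ c₃ * h ^ 3 + 2 * c₂ * h ^ 2 := by linarith

omit [Fintype ι] [DecidableEq V] in
/-- **THE TWO-SITE PERTURBED FAMILY IS REGULATED, UNIFORMLY IN `|s|, |t| ≤ 1`**: with `2(κ₀+2c₂) ≤ κ`, every cell factor obeys
`‖e^{−Σ_{x∈cell p}w̃_x(ω_x)} − 1‖ ≤ ε̃·e^{½κΣ_{cell p}ω²}`, `ε̃ = max(e^{v(c₃h³+2c₂h²)}−1, 2e^{−(κ∕2−(κ₀+2c₂))h²})`. [folklore] -/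
theorem twoSite_regulated (cell : V → Finset ι) {v : ℕ} (hv : ∀ p, (cell p).card ≤ v) {κ₀ c₂ c₃ h κ : ℝ} (hκ₀ : 0 ≤ κ₀) (hc₂ : 0 ≤ c₂)
    (hc₃ : 0 ≤ c₃) (hh : 0 ≤ h) (hstab : ∀ x, ∀ u : ℝ, -(κ₀ * u ^ 2) ≤ w x u) (hcub : ∀ x, ∀ u : ℝ, |u| ≤ h → |w x u| ≤ c₃ * |u| ^ 3)
    (hFq : ∀ x u, |F x u| ≤ c₂ * u ^ 2) (hGq : ∀ x u, |G x u| ≤ c₂ * u ^ 2) (hκ : 2 * (κ₀ + 2 * c₂) ≤ κ) (hs : |s| ≤ 1) (ht : |t| ≤ 1)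
    (p : V) (ω : EuclideanSpace ℝ ι) :
    ‖(((exp (-(∑ x ∈ cell p, (w x (ω x) - s * (if x = y then F x (ω x) else 0) - t * (if x = z then G x (ω x) else 0)))) - 1 : ℝ)) : ℂ)‖ ≤
      max (exp (v * (c₃ * h ^ 3 + 2 * c₂ * h ^ 2)) - 1) (2 * exp (-((κ / 2 - (κ₀ + 2 * c₂)) * h ^ 2))) * exp (κ * (∑ x ∈ cell p, ω x ^ 2) / 2) :=
  supSmall_factor_norm_le cell hv (fun x u => w x u - s * (if x = y then F x u else 0) - t * (if x = z then G x u else 0)) (by positivity)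
    (by positivity) hh (twoSite_stable w F G y z s t hc₂ hstab hFq hGq hs ht) (twoSite_supSmall w F G y z s t hc₃ hc₂ hcub hFq hGq hs ht)
    hκ p ω

end TwoSite

/-! ## §2. THE END: the mixed second difference of the small-field free energy under two far-apart one-site perturbations -/

section Main

variable {Γ : Matrix ι ι ℝ} {γop γ : ℝ} {dι : ι → ι → ℕ} {ρ : ℕ} {cell : V → Finset ι} {v : ℕ} {R : V → V → Prop}
  [DecidableRel R] [Std.Symm R] {nbr : V → Finset V} {Δ : ℕ} {w F G : ι → ℝ → ℝ} {κ₀ c₂ c₃ h κ τ θ Ψ η : ℝ}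

/-- **THE END — TWO ONE-SITE PERTURBATIONS AT FAR-APART CELLS MOVE THE SMALL-FIELD FREE ENERGY BY AN EXPONENTIALLY SMALL MIXED AMOUNT.**
Road data as in (315) (`Γ ⪰ 0` of range `ρ`, `Γ ⪯ γ_op·1`, diagonal `≤ γ`, `γ ≥ 0`; disjoint cells of `≤ v` sites; `R` symmetric covering
`ρ`-closeness, `≤ Δ` neighbours; measurable `w, F, G`, `−κ₀t² ≤ w`, `|w| ≤ c₃|t|³` on `|t| ≤ h`, `|F|, |G| ≤ c₂t²`; `2(κ₀+2c₂) ≤ κ`,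
`κ(1+τ)γ_op ≤ θ < 1`; `ψ₀` small on the cells of `S`); `y ∈ cell p₀`, `z ∈ cell p₁`; a potential `d` on the cells with `d q ≤ d p + 1` whenever
`R p q`, `d p₀ = 0`, `n + 2 ≤ d p₁`; `0 ≤ η` and the DECAY smallness `e^{1+η}·ε̃_ΨA_τ^v·(Δ+1)² ≤ ½` ⟹ for all `|s|, |t| ≤ 1`,
`|log Z(s,t) − log Z(s,0) − log Z(0,t) + log Z(0,0)| ≤ 4·e^{−η(n+1)}·(1·(Δ+1)·2e^{1+η}·ε̃_ΨA_τ^v)`,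
`Z(s,t) = ∫e^{−Σ_{p∈S}Σ_{x∈cell p}(w_x − s1_{x=y}F_x − t1_{x=z}G_x)(ω_x+ψ₀,x)}dN(0,Γ)`. [folklore] -/
theorem abs_log_twoSite_mixed_le (hΓ : Γ.PosSemidef) (hΓop : (γop • (1 : Matrix ι ι ℝ) - Γ).PosSemidef) (hdiag : ∀ i, Γ i i ≤ γ)
    (hγ : 0 ≤ γ) (hfr : HasFiniteRange dι ρ Γ) (hdisj : ∀ p q, p ≠ q → Disjoint (cell p) (cell q)) (hv : ∀ p, (cell p).card ≤ v)
    (hR : ∀ (p p' : V) (x y : ι), x ∈ cell p → y ∈ cell p' → dι x y ≤ ρ → p = p' ∨ R p p')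
    (hΔ : ∀ x, (nbr x).card ≤ Δ) (hnbr : ∀ x y, R x y → y ∈ nbr x) (hw : ∀ x, Measurable (w x)) (hFm : ∀ x, Measurable (F x))
    (hGm : ∀ x, Measurable (G x)) (hκ₀ : 0 ≤ κ₀) (hc₂ : 0 ≤ c₂) (hc₃ : 0 ≤ c₃) (hh : 0 ≤ h) (hstab : ∀ x, ∀ u : ℝ, -(κ₀ * u ^ 2) ≤ w x u)
    (hcub : ∀ x, ∀ u : ℝ, |u| ≤ h → |w x u| ≤ c₃ * |u| ^ 3) (hFq : ∀ x u, |F x u| ≤ c₂ * u ^ 2) (hGq : ∀ x u, |G x u| ≤ c₂ * u ^ 2)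
    (hκ : 2 * (κ₀ + 2 * c₂) ≤ κ) (hτ : 0 < τ) (hθ0 : 0 < θ) (hθ1 : θ < 1) (hκθ : κ * (1 + τ) * γop ≤ θ) (S : Finset V)
    (ψ₀ : EuclideanSpace ℝ ι) (hψ : ∀ p ∈ S, ∑ x ∈ cell p, ψ₀ x ^ 2 ≤ Ψ ^ 2) {p₀ p₁ : V} {y z : ι} (hy : y ∈ cell p₀) (hz : z ∈ cell p₁)
    {d : V → ℕ} (hd : ∀ p q, R p q → d q ≤ d p + 1) {n : ℕ} (hd₀ : d p₀ = 0) (hd₁ : n + 2 ≤ d p₁) (hη : 0 ≤ η)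
    (hsmall : Real.exp (1 + η) * (((max (exp (v * (c₃ * h ^ 3 + 2 * c₂ * h ^ 2)) - 1) (2 * exp (-((κ / 2 - (κ₀ + 2 * c₂)) * h ^ 2)))) *
      exp (κ * (1 + τ⁻¹) * Ψ ^ 2 / 2)) * ((1 - θ) ^ (-(κ * (1 + τ) * γ / (2 * θ)))) ^ v) * ((Δ : ℝ) + 1) ^ 2 ≤ 1 / 2)
    {s t : ℝ} (hs : |s| ≤ 1) (ht : |t| ≤ 1) :
    |log (∫ ω : EuclideanSpace ℝ ι, exp (-(∑ p ∈ S, ∑ x ∈ cell p,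
          (w x (ω x + ψ₀ x) - s * (if x = y then F x (ω x + ψ₀ x) else 0) - t * (if x = z then G x (ω x + ψ₀ x) else 0))))
          ∂(multivariateGaussian 0 Γ)) -
        log (∫ ω : EuclideanSpace ℝ ι, exp (-(∑ p ∈ S, ∑ x ∈ cell p,
          (w x (ω x + ψ₀ x) - s * (if x = y then F x (ω x + ψ₀ x) else 0) - 0 * (if x = z then G x (ω x + ψ₀ x) else 0))))
          ∂(multivariateGaussian 0 Γ)) -
        log (∫ ω : EuclideanSpace ℝ ι, exp (-(∑ p ∈ S, ∑ x ∈ cell p,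
          (w x (ω x + ψ₀ x) - 0 * (if x = y then F x (ω x + ψ₀ x) else 0) - t * (if x = z then G x (ω x + ψ₀ x) else 0))))
          ∂(multivariateGaussian 0 Γ)) +
        log (∫ ω : EuclideanSpace ℝ ι, exp (-(∑ p ∈ S, ∑ x ∈ cell p,
          (w x (ω x + ψ₀ x) - 0 * (if x = y then F x (ω x + ψ₀ x) else 0) - 0 * (if x = z then G x (ω x + ψ₀ x) else 0))))
          ∂(multivariateGaussian 0 Γ))| ≤
      4 * (Real.exp (-(η * ((n : ℝ) + 1))) * ((1 : ℝ) * ((Δ : ℝ) + 1) * (2 * (Real.exp (1 + η) *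
        (((max (exp (v * (c₃ * h ^ 3 + 2 * c₂ * h ^ 2)) - 1) (2 * exp (-((κ / 2 - (κ₀ + 2 * c₂)) * h ^ 2)))) *
          exp (κ * (1 + τ⁻¹) * Ψ ^ 2 / 2)) * ((1 - θ) ^ (-(κ * (1 + τ) * γ / (2 * θ)))) ^ v))))) := by
  set μ := multivariateGaussian 0 Γ with hμ
  -- the four remainder families, handled uniformly through the parameters `(r, r')` with `|r|, |r'| ≤ 1`
  set wt : ℝ → ℝ → ι → ℝ → ℝ := fun r r' x u => w x u - r * (if x = y then F x u else 0) - r' * (if x = z then G x u else 0) with hwt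
  set ε : ℝ := max (exp (v * (c₃ * h ^ 3 + 2 * c₂ * h ^ 2)) - 1) (2 * exp (-((κ / 2 - (κ₀ + 2 * c₂)) * h ^ 2))) with hε
  have hε0 : 0 ≤ ε := supSmall_eps_nonneg v _ h κ _
  have hκ' : 0 ≤ κ := by linarith
  have hκτ : 0 ≤ κ * (1 + τ) := mul_nonneg hκ' (by linarith)
  have h1θ : 0 < 1 - θ := by linarith
  have hs0 : |(0 : ℝ)| ≤ 1 := by rw [abs_zero]; exact zero_le_one
  have hsmall₁ := smallness_of_decay (Δ := Δ) (mul_nonneg (mul_nonneg hε0 (exp_pos _).le) (pow_nonneg (rpow_pos_of_pos h1θ _).le _))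
    hη hsmall
  -- the generic facts for `(r, r')` with `|r|, |r'| ≤ 1`
  have hreg : ∀ r r' : ℝ, |r| ≤ 1 → |r'| ≤ 1 → ∀ p (ω : EuclideanSpace ℝ ι),
      ‖(((exp (-(∑ x ∈ cell p, wt r r' x (ω x))) - 1 : ℝ)) : ℂ)‖ ≤ ε * exp (κ * (∑ x ∈ cell p, ω x ^ 2) / 2) :=
    fun r r' hr hr' p ω => twoSite_regulated w F G y z r r' cell hv hκ₀ hc₂ hc₃ hh hstab hcub hFq hGq hκ hr hr' p ω
  have hmeas : ∀ r r' : ℝ, ∀ p, Measurable[MeasurableSpace.comap (fun (ω : EuclideanSpace ℝ ι) (x : cell p) => ω x) inferInstance]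
      (fun ω : EuclideanSpace ℝ ι => (((exp (-(∑ x ∈ cell p, wt r r' x (ω x))) - 1 : ℝ)) : ℂ)) :=
    fun r r' p => road_factor_measurable cell (wt r r') (fun x => twoSite_measurable w F G y z r r' hw hFm hGm x) p
  -- real logarithm = real part of the KP logarithm, for each family
  have hreal : ∀ r r' : ℝ, |r| ≤ 1 → |r'| ≤ 1 →
      (pertLogZ μ (fun p ω => (((exp (-(∑ x ∈ cell p, wt r r' x ((ω + ψ₀) x))) - 1 : ℝ)) : ℂ)) R S).re =
        log (∫ ω : EuclideanSpace ℝ ι, exp (-(∑ p ∈ S, ∑ x ∈ cell p, wt r r' x (ω x + ψ₀ x))) ∂μ) := by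
    intro r r' hr hr'
    have hexp := shifted_exp_pertLogZ_on hΓ hΓop hdiag hγ hfr cell hdisj hv hR hΔ hnbr hε0 hκ' hτ hθ0 hθ1 hκθ S
      (g := fun p ω => (((exp (-(∑ x ∈ cell p, wt r r' x (ω x))) - 1 : ℝ)) : ℂ))
      (fun p _ => hmeas r r' p) (fun p _ ω => hreg r r' hr hr' p ω) ψ₀ hψ hsmall₁
    have hZ := pertZ_road_shift_eq μ cell (wt r r') S ψ₀
    rw [hZ] at hexp
    have hne : pertZ μ (fun p ω => (((exp (-(∑ x ∈ cell p, wt r r' x ((ω + ψ₀) x))) - 1 : ℝ)) : ℂ)) S ≠ 0 := by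
      rw [hZ, ← hexp]; exact Complex.exp_ne_zero _
    have hr0 : 0 ≤ ∫ ω : EuclideanSpace ℝ ι, exp (-(∑ p ∈ S, ∑ x ∈ cell p, wt r r' x (ω x + ψ₀ x))) ∂μ :=
      integral_nonneg fun ω => (exp_pos _).le
    have hpos : 0 < ∫ ω : EuclideanSpace ℝ ι, exp (-(∑ p ∈ S, ∑ x ∈ cell p, wt r r' x (ω x + ψ₀ x))) ∂μ := by
      refine lt_of_le_of_ne hr0 fun h0 => hne ?_
      rw [hZ, ← h0, Complex.ofReal_zero]
    exact re_eq_log_of_exp_eq hpos hexp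
  -- rewrite the four logarithms as real parts of KP logarithms of the cut-off shifted families
  rw [show (fun ω : EuclideanSpace ℝ ι => exp (-(∑ p ∈ S, ∑ x ∈ cell p,
      (w x (ω x + ψ₀ x) - s * (if x = y then F x (ω x + ψ₀ x) else 0) - t * (if x = z then G x (ω x + ψ₀ x) else 0))))) =
      fun ω => exp (-(∑ p ∈ S, ∑ x ∈ cell p, wt s t x (ω x + ψ₀ x))) from rfl,
    show (fun ω : EuclideanSpace ℝ ι => exp (-(∑ p ∈ S, ∑ x ∈ cell p,
      (w x (ω x + ψ₀ x) - s * (if x = y then F x (ω x + ψ₀ x) else 0) - 0 * (if x = z then G x (ω x + ψ₀ x) else 0))))) =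
      fun ω => exp (-(∑ p ∈ S, ∑ x ∈ cell p, wt s 0 x (ω x + ψ₀ x))) from rfl,
    show (fun ω : EuclideanSpace ℝ ι => exp (-(∑ p ∈ S, ∑ x ∈ cell p,
      (w x (ω x + ψ₀ x) - 0 * (if x = y then F x (ω x + ψ₀ x) else 0) - t * (if x = z then G x (ω x + ψ₀ x) else 0))))) =
      fun ω => exp (-(∑ p ∈ S, ∑ x ∈ cell p, wt 0 t x (ω x + ψ₀ x))) from rfl,
    show (fun ω : EuclideanSpace ℝ ι => exp (-(∑ p ∈ S, ∑ x ∈ cell p,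
      (w x (ω x + ψ₀ x) - 0 * (if x = y then F x (ω x + ψ₀ x) else 0) - 0 * (if x = z then G x (ω x + ψ₀ x) else 0))))) =
      fun ω => exp (-(∑ p ∈ S, ∑ x ∈ cell p, wt 0 0 x (ω x + ψ₀ x))) from rfl,
    ← hreal s t hs ht, ← hreal s 0 hs hs0, ← hreal 0 t hs0 ht, ← hreal 0 0 hs0 hs0, ← Complex.sub_re, ← Complex.sub_re, ← Complex.add_re]
  refine (Complex.abs_re_le_norm _).trans ?_
  -- localise to `S`
  rw [← pertLogZ_cutoff μ (fun p ω => (((exp (-(∑ x ∈ cell p, wt s t x ((ω + ψ₀) x))) - 1 : ℝ)) : ℂ)) R S,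
    ← pertLogZ_cutoff μ (fun p ω => (((exp (-(∑ x ∈ cell p, wt s 0 x ((ω + ψ₀) x))) - 1 : ℝ)) : ℂ)) R S,
    ← pertLogZ_cutoff μ (fun p ω => (((exp (-(∑ x ∈ cell p, wt 0 t x ((ω + ψ₀) x))) - 1 : ℝ)) : ℂ)) R S,
    ← pertLogZ_cutoff μ (fun p ω => (((exp (-(∑ x ∈ cell p, wt 0 0 x ((ω + ψ₀) x))) - 1 : ℝ)) : ℂ)) R S]
  have hA0 : 0 ≤ (ε * exp (κ * (1 + τ⁻¹) * Ψ ^ 2 / 2)) * ((1 - θ) ^ (-(κ * (1 + τ) * γ / (2 * θ)))) ^ v :=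
    mul_nonneg (mul_nonneg hε0 (exp_pos _).le) (pow_nonneg (rpow_pos_of_pos h1θ _).le _)
  have hact : ∀ r r' : ℝ, |r| ≤ 1 → |r'| ≤ 1 → ∀ K : Finset V, IsRConnected R K →
      ‖cellActivity μ (fun p ω => if p ∈ S then
        (fun p ω => (((exp (-(∑ x ∈ cell p, wt r r' x (ω x))) - 1 : ℝ)) : ℂ)) p (ω + ψ₀) else 0) K‖ ≤
        ((ε * exp (κ * (1 + τ⁻¹) * Ψ ^ 2 / 2)) * ((1 - θ) ^ (-(κ * (1 + τ) * γ / (2 * θ)))) ^ v) ^ K.card :=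
    fun r r' hr hr' K _ => norm_cellActivity_le_of_regulated hΓ hΓop hdiag hγ cell hdisj hv (mul_nonneg hε0 (exp_pos _).le) hκτ hθ0 hθ1
      hκθ (cutoff_shifted_regulated cell hε0 hκ' hτ S (fun p _ ω => hreg r r' hr hr' p ω) ψ₀ hψ) K
  -- the agreement letters: off `{p₀}` the factors do not see `r`; off `{p₁}` they do not see `r'`
  have hagree_s : ∀ r₁ r₂ r' : ℝ, ∀ K : Finset V, K ⊆ S → Disjoint K {p₀} →
      cellActivity μ (fun p ω => if p ∈ S then
        (fun p ω => (((exp (-(∑ x ∈ cell p, wt r₁ r' x (ω x))) - 1 : ℝ)) : ℂ)) p (ω + ψ₀) else 0) K =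
      cellActivity μ (fun p ω => if p ∈ S then
        (fun p ω => (((exp (-(∑ x ∈ cell p, wt r₂ r' x (ω x))) - 1 : ℝ)) : ℂ)) p (ω + ψ₀) else 0) K := by
    intro r₁ r₂ r' K hKS hKD
    rw [cellActivity_cutoff_of_subset μ _ hKS, cellActivity_cutoff_of_subset μ _ hKS]
    unfold cellActivity
    refine integral_congr_ae (ae_of_all _ fun ω => prod_congr rfl fun p hp => ?_)
    have hpp : p ≠ p₀ := fun h0 => Finset.disjoint_left.1 hKD hp (by rw [h0]; exact mem_singleton_self _)
    have hsum : ∑ x ∈ cell p, wt r₁ r' x ((ω + ψ₀) x) = ∑ x ∈ cell p, wt r₂ r' x ((ω + ψ₀) x) := by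
      refine sum_congr rfl fun x hx => ?_
      have hxy : x ≠ y := fun h0 => Finset.disjoint_left.1 (hdisj p p₀ hpp) hx (h0 ▸ hy)
      simp [hwt, hxy]
    simp only [hsum]
  have hagree_t : ∀ r r'₁ r'₂ : ℝ, ∀ K : Finset V, K ⊆ S → Disjoint K {p₁} →
      cellActivity μ (fun p ω => if p ∈ S then
        (fun p ω => (((exp (-(∑ x ∈ cell p, wt r r'₁ x (ω x))) - 1 : ℝ)) : ℂ)) p (ω + ψ₀) else 0) K =
      cellActivity μ (fun p ω => if p ∈ S then
        (fun p ω => (((exp (-(∑ x ∈ cell p, wt r r'₂ x (ω x))) - 1 : ℝ)) : ℂ)) p (ω + ψ₀) else 0) K := by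
    intro r r'₁ r'₂ K hKS hKD
    rw [cellActivity_cutoff_of_subset μ _ hKS, cellActivity_cutoff_of_subset μ _ hKS]
    unfold cellActivity
    refine integral_congr_ae (ae_of_all _ fun ω => prod_congr rfl fun p hp => ?_)
    have hpp : p ≠ p₁ := fun h0 => Finset.disjoint_left.1 hKD hp (by rw [h0]; exact mem_singleton_self _)
    have hsum : ∑ x ∈ cell p, wt r r'₁ x ((ω + ψ₀) x) = ∑ x ∈ cell p, wt r r'₂ x ((ω + ψ₀) x) := by
      refine sum_congr rfl fun x hx => ?_
      have hxz : x ≠ z := fun h0 => Finset.disjoint_left.1 (hdisj p p₁ hpp) hx (h0 ▸ hz)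
      simp [hwt, hxz]
    simp only [hsum]
  -- the separation letter from the potential `d` ((325))
  have hsep : ∀ 𝒞 ∈ (rconnSubsets R S).powerset, IsPolymerCluster (GeomInc R) 𝒞 →
      (∃ q ∈ ({p₀} : Finset V), KPTouches (GeomInc R) 𝒞 {q}) → (∃ q ∈ ({p₁} : Finset V), KPTouches (GeomInc R) 𝒞 {q}) →
      (n : ℝ) + 1 ≤ ∑ Y ∈ 𝒞, (Y.card : ℝ) := by
    intro 𝒞 h𝒞 hcl hA hB
    obtain ⟨q, hq, hqa⟩ := hA
    obtain ⟨q', hq', hqb⟩ := hB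
    rw [mem_singleton] at hq hq'
    subst hq hq'
    exact cluster_size_ge_of_touches symm_of_inst hd hd₀ hd₁ h𝒞 hcl hqa hqb
  have key := act_norm_pertLogZ_mixed_le (μ := μ) (R := R) symm_of_inst hΔ hnbr (hact 0 0 hs0 hs0) (hact s 0 hs hs0) (hact 0 t hs0 ht)
    (hact s t hs ht) hA0 hη hsmall S {p₀} {p₁}
    (fun K hKS hKD => ⟨hagree_s s 0 0 K hKS hKD, hagree_s s 0 t K hKS hKD⟩)
    (fun K hKS hKD => ⟨hagree_t 0 t 0 K hKS hKD, hagree_t s t 0 K hKS hKD⟩) hsep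
  rw [card_singleton, Nat.cast_one] at key
  exact key

end Main

/-! ## §3. Toy -/

/-- Toy (§1): the two-site perturbation of the ZERO remainder by zero profiles is stable with constant `0 + 2·0`. -/
example (y z : Fin 2) (u : ℝ) :
    -((0 + 2 * 0) * u ^ 2) ≤ (fun (_ : Fin 2) (_ : ℝ) => (0 : ℝ)) 0 u - 1 * (if (0 : Fin 2) = y then (fun (_ : Fin 2) (_ : ℝ) => (0 : ℝ)) 0 u else 0) -
      1 * (if (0 : Fin 2) = z then (fun (_ : Fin 2) (_ : ℝ) => (0 : ℝ)) 0 u else 0) :=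
  twoSite_stable (fun _ _ => 0) (fun _ _ => 0) (fun _ _ => 0) y z 1 1 le_rfl (fun _ _ => by simp) (fun _ _ => by simp) (fun _ _ => by simp)
    (by rw [abs_one]) (by rw [abs_one]) 0 u

end Summit.QuantumFields.BalabanUV.T4Continuum.NE7b.SupTwoSitePerturbationLocality
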